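import Mathlib.Analysis.Complex.CauchyIntegral
import Mathlib.MeasureTheory.Integral.DominatedConvergence
import Literature.Analysis.Complex.RectangleCauchyFormula
import HarnessLib

/-!
# Cauchy's integral formula over a grid cycle (Conway VIII.1.1)

Let `K` be a compact subset of an open set `Ω ⊆ ℂ`. Covering `K` by the closed squares of a
fine square grid that meet `K` and adding up the (counter-clockwise) boundary integrals of these
squares, the interior edges cancel and the surviving edges avoid `K`; by Cauchy's theorem and
Cauchy's formula for a single square one obtains finitely many axis-parallel segments
`γ₁, …, γₙ ⊆ Ω \ K` such that `f(z) = ∑ₖ (2πi)⁻¹ ∫_{γₖ} f(w)/(w - z) dw` for every `f`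
holomorphic on `Ω` and every `z ∈ K` (Conway, Prop. VIII.1.1). This is the starting point of
Runge's theorem (`Literature.Analysis.Complex.Runge`).

## Main definitions and results

* `Complex.gridSquare δ p`, `Complex.gridOpenSquare δ p`: the closed/open square of mesh `δ`
  with lower-left corner `(p.1 δ, p.2 δ)`, `p : ℤ × ℤ`; `Complex.gridHEdge`, `Complex.gridVEdge`:
  the grid edges; `Complex.gridHIntegral`, `Complex.gridVIntegral`: integrals along them;
  `Complex.gridBoundaryIntegral`: the boundary integral of a square in Mathlib's four-term
  convention; `Complex.gridHCoeff S`, `Complex.gridVCoeff S`: the coefficients (`-1, 0, 1`) of the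
  edges in the grid cycle `∑_{p ∈ S} ∂Q_p`.
* `Complex.sum_gridBoundaryIntegral_eq`: cancellation of interior edges (Conway (1.2)).
* `Complex.continuousOn_integral_div_sub`: `z ↦ ∫_a^b φ(x)/(γ(x) - z) dx` is continuous off
  `γ([a, b])`.
* `Complex.exists_grid_cauchy_formula`: **Conway VIII.1.1**.

We work in the namespace `Complex` (deliberate dot-notation extension of Mathlib's namespace, as
in the sibling files `Montel`, `Hurwitz`, `RiemannMapping`).

## Mathlib

We USE `Complex.integral_boundary_rect_eq_zero_of_differentiableOn` (Cauchy–Goursat for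
rectangles), `Literature.Analysis.Complex.integral_boundary_rect_div_sub_eq` (Cauchy's formula for a rectangle,
`Literature.Analysis.Complex.RectangleCauchyFormula`), `Complex.reProdIm` (`×ℂ`),
`intervalIntegral.continuous_parametric_intervalIntegral_of_continuous'`, `Set.IccExtend`,
`IsCompact.exists_cthickening_subset_open`, `Set.EqOn.of_subset_closure`.

## References

* J. B. Conway, *Functions of One Complex Variable I*, 2nd ed., GTM 11, Springer (1978),
  Ch. VIII §1, Prop. 1.1 (pp. 195–197).
-/

noncomputable section

open Set Filter Topology MeasureTheory intervalIntegral Metric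

namespace Complex

variable (δ : ℝ)

/-- The closed grid square of mesh `δ` with lower-left corner `(p.1 δ, p.2 δ)`. [folklore] -/
def gridSquare (p : ℤ × ℤ) : Set ℂ :=
  Icc ((p.1 : ℝ) * δ) ((p.1 + 1 : ℝ) * δ) ×ℂ Icc ((p.2 : ℝ) * δ) ((p.2 + 1 : ℝ) * δ)

/-- The open grid square of mesh `δ` with lower-left corner `(p.1 δ, p.2 δ)`. [folklore] -/
def gridOpenSquare (p : ℤ × ℤ) : Set ℂ :=
  Ioo ((p.1 : ℝ) * δ) ((p.1 + 1 : ℝ) * δ) ×ℂ Ioo ((p.2 : ℝ) * δ) ((p.2 + 1 : ℝ) * δ)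

/-- The horizontal grid edge of mesh `δ` with left endpoint `(q.1 δ, q.2 δ)` (the bottom edge of
the square `q`, the top edge of the square `(q.1, q.2 - 1)`). [folklore] -/
def gridHEdge (q : ℤ × ℤ) : Set ℂ :=
  Icc ((q.1 : ℝ) * δ) ((q.1 + 1 : ℝ) * δ) ×ℂ {(q.2 : ℝ) * δ}

/-- The vertical grid edge of mesh `δ` with lower endpoint `(q.1 δ, q.2 δ)` (the left edge of the
square `q`, the right edge of the square `(q.1 - 1, q.2)`). [folklore] -/
def gridVEdge (q : ℤ × ℤ) : Set ℂ :=
  {(q.1 : ℝ) * δ} ×ℂ Icc ((q.2 : ℝ) * δ) ((q.2 + 1 : ℝ) * δ)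

/-- The integral `∫ g(x + i q.2 δ) dx` of `g` along the horizontal grid edge `q`, from left to
right. [folklore] -/
def gridHIntegral (q : ℤ × ℤ) (g : ℂ → ℂ) : ℂ :=
  ∫ x : ℝ in ((q.1 : ℝ) * δ)..((q.1 + 1 : ℝ) * δ), g (x + ((q.2 : ℝ) * δ : ℝ) * I)

/-- The integral `∫ g(q.1 δ + i y) dy` of `g` along the vertical grid edge `q`, from bottom to top
(with respect to `dy`, i.e. without the factor `i` of `dz = i dy`). [folklore] -/
def gridVIntegral (q : ℤ × ℤ) (g : ℂ → ℂ) : ℂ :=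
  ∫ y : ℝ in ((q.2 : ℝ) * δ)..((q.2 + 1 : ℝ) * δ), g (((q.1 : ℝ) * δ : ℝ) + y * I)

/-- The boundary integral `∮_{∂Q} g(z) dz` of the grid square `p` (counter-clockwise), in the
four-term convention of Mathlib's `Complex.integral_boundary_rect_eq_zero_of_differentiableOn`
(bottom − top + i·right − i·left). [folklore] -/
def gridBoundaryIntegral (p : ℤ × ℤ) (g : ℂ → ℂ) : ℂ :=
  gridHIntegral δ p g - gridHIntegral δ (p.1, p.2 + 1) g +
    I * gridVIntegral δ (p.1 + 1, p.2) g - I * gridVIntegral δ p g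

/-- The coefficient of the horizontal edge `q` in the grid cycle `∑_{p ∈ S} ∂Q_p`:
`[q ∈ S] - [(q.1, q.2 - 1) ∈ S]` (the edge is the bottom edge of `q`, traversed positively, and
the top edge of `(q.1, q.2 - 1)`, traversed negatively). [folklore] -/
def gridHCoeff (S : Finset (ℤ × ℤ)) (q : ℤ × ℤ) : ℤ :=
  (if q ∈ S then 1 else 0) - (if (q.1, q.2 - 1) ∈ S then 1 else 0)

/-- The coefficient of the vertical edge `q` in the grid cycle `∑_{p ∈ S} ∂Q_p`:
`[(q.1 - 1, q.2) ∈ S] - [q ∈ S]` (the edge is the right edge of `(q.1 - 1, q.2)`, traversed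
upwards, and the left edge of `q`, traversed downwards). [folklore] -/
def gridVCoeff (S : Finset (ℤ × ℤ)) (q : ℤ × ℤ) : ℤ :=
  (if (q.1 - 1, q.2) ∈ S then 1 else 0) - (if q ∈ S then 1 else 0)

variable {δ}

/-- **Cancellation of interior edges.** The sum of the boundary integrals of the squares of `S`
is the combination of edge integrals with the coefficients `gridHCoeff S`, `gridVCoeff S`, summed
over any finite index set `T` containing `S` and its upward and rightward translates. Conway
(1978), VIII.1.1, eq. (1.2). [cite: Conway1978, Ch. VIII Prop. 1.1] -/
theorem sum_gridBoundaryIntegral_eq {S T : Finset (ℤ × ℤ)} (hST : S ⊆ T)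
    (hup : S.image (fun p ↦ (p.1, p.2 + 1)) ⊆ T)
    (hright : S.image (fun p ↦ (p.1 + 1, p.2)) ⊆ T) (g : ℂ → ℂ) :
    ∑ p ∈ S, gridBoundaryIntegral δ p g =
      ∑ q ∈ T, (gridHCoeff S q : ℂ) * gridHIntegral δ q g +
        I * ∑ q ∈ T, (gridVCoeff S q : ℂ) * gridVIntegral δ q g := by
  classical
  -- the four sums
  have h1 : ∑ q ∈ T, (if q ∈ S then gridHIntegral δ q g else 0) = ∑ p ∈ S, gridHIntegral δ p g := by
    rw [Finset.sum_ite_mem, Finset.inter_eq_right.2 hST]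
  have h2 : ∑ q ∈ T, (if (q.1, q.2 - 1) ∈ S then gridHIntegral δ q g else 0) =
      ∑ p ∈ S, gridHIntegral δ (p.1, p.2 + 1) g := by
    rw [← Finset.sum_filter]
    have hset : T.filter (fun q ↦ (q.1, q.2 - 1) ∈ S) = S.image (fun p ↦ (p.1, p.2 + 1)) := by
      ext q
      simp only [Finset.mem_filter, Finset.mem_image]
      constructor
      · rintro ⟨-, hq⟩
        exact ⟨_, hq, by simp⟩
      · rintro ⟨p, hp, rfl⟩
        exact ⟨hup (Finset.mem_image_of_mem _ hp), by simpa using hp⟩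
    rw [hset, Finset.sum_image]
    intro p _ p' _ h
    simp only [Prod.mk.injEq, add_left_inj] at h
    exact Prod.ext h.1 h.2
  have h3 : ∑ q ∈ T, (if q ∈ S then gridVIntegral δ q g else 0) = ∑ p ∈ S, gridVIntegral δ p g := by
    rw [Finset.sum_ite_mem, Finset.inter_eq_right.2 hST]
  have h4 : ∑ q ∈ T, (if (q.1 - 1, q.2) ∈ S then gridVIntegral δ q g else 0) =
      ∑ p ∈ S, gridVIntegral δ (p.1 + 1, p.2) g := by
    rw [← Finset.sum_filter]
    have hset : T.filter (fun q ↦ (q.1 - 1, q.2) ∈ S) = S.image (fun p ↦ (p.1 + 1, p.2)) := by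
      ext q
      simp only [Finset.mem_filter, Finset.mem_image]
      constructor
      · rintro ⟨-, hq⟩
        exact ⟨_, hq, by simp⟩
      · rintro ⟨p, hp, rfl⟩
        exact ⟨hright (Finset.mem_image_of_mem _ hp), by simpa using hp⟩
    rw [hset, Finset.sum_image]
    intro p _ p' _ h
    simp only [Prod.mk.injEq, add_left_inj] at h
    exact Prod.ext h.1 h.2
  -- expand the coefficients
  have hH : ∑ q ∈ T, (gridHCoeff S q : ℂ) * gridHIntegral δ q g =
      ∑ p ∈ S, gridHIntegral δ p g - ∑ p ∈ S, gridHIntegral δ (p.1, p.2 + 1) g := by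
    rw [← h1, ← h2, ← Finset.sum_sub_distrib]
    refine Finset.sum_congr rfl fun q _ ↦ ?_
    simp only [gridHCoeff]
    split_ifs <;> push_cast <;> ring
  have hV : ∑ q ∈ T, (gridVCoeff S q : ℂ) * gridVIntegral δ q g =
      ∑ p ∈ S, gridVIntegral δ (p.1 + 1, p.2) g - ∑ p ∈ S, gridVIntegral δ p g := by
    rw [← h3, ← h4, ← Finset.sum_sub_distrib]
    refine Finset.sum_congr rfl fun q _ ↦ ?_
    simp only [gridVCoeff]
    split_ifs <;> push_cast <;> ring
  rw [hH, hV]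
  simp only [gridBoundaryIntegral, Finset.sum_add_distrib, Finset.sum_sub_distrib, ← Finset.mul_sum]
  ring


/-! ### Geometry of the grid -/

section Geometry

/-- Every point lies in the closed grid square indexed by the integer parts of its coordinates
divided by the mesh. [folklore] -/
theorem mem_gridSquare_floor (hδ : 0 < δ) (z : ℂ) :
    z ∈ gridSquare δ (⌊z.re / δ⌋, ⌊z.im / δ⌋) := by
  refine ⟨⟨?_, ?_⟩, ⟨?_, ?_⟩⟩
  · have := Int.floor_le (z.re / δ)
    calc ((⌊z.re / δ⌋ : ℤ) : ℝ) * δ ≤ z.re / δ * δ := by gcongr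
      _ = z.re := div_mul_cancel₀ _ hδ.ne'
  · have := (Int.lt_floor_add_one (z.re / δ)).le
    calc z.re = z.re / δ * δ := (div_mul_cancel₀ _ hδ.ne').symm
      _ ≤ ((⌊z.re / δ⌋ : ℤ) + 1 : ℝ) * δ := by gcongr
  · have := Int.floor_le (z.im / δ)
    calc ((⌊z.im / δ⌋ : ℤ) : ℝ) * δ ≤ z.im / δ * δ := by gcongr
      _ = z.im := div_mul_cancel₀ _ hδ.ne'
  · have := (Int.lt_floor_add_one (z.im / δ)).le
    calc z.im = z.im / δ * δ := (div_mul_cancel₀ _ hδ.ne').symm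
      _ ≤ ((⌊z.im / δ⌋ : ℤ) + 1 : ℝ) * δ := by gcongr

/-- A point of the open square `p₀` lies in no other closed square. [folklore] -/
theorem eq_of_mem_gridOpenSquare_of_mem_gridSquare (hδ : 0 < δ) {z : ℂ} {p₀ p : ℤ × ℤ}
    (h₀ : z ∈ gridOpenSquare δ p₀) (h : z ∈ gridSquare δ p) : p = p₀ := by
  obtain ⟨⟨h1, h2⟩, ⟨h3, h4⟩⟩ := h₀
  obtain ⟨⟨h5, h6⟩, ⟨h7, h8⟩⟩ := h
  have k1 : ((p.1 : ℤ) : ℝ) < p₀.1 + 1 := lt_of_mul_lt_mul_right (h5.trans_lt h2) hδ.le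
  have k2 : ((p₀.1 : ℤ) : ℝ) < p.1 + 1 := lt_of_mul_lt_mul_right (h1.trans_le h6) hδ.le
  have k3 : ((p.2 : ℤ) : ℝ) < p₀.2 + 1 := lt_of_mul_lt_mul_right (h7.trans_lt h4) hδ.le
  have k4 : ((p₀.2 : ℤ) : ℝ) < p.2 + 1 := lt_of_mul_lt_mul_right (h3.trans_le h8) hδ.le
  have e1 : p.1 < p₀.1 + 1 := by exact_mod_cast k1
  have e2 : p₀.1 < p.1 + 1 := by exact_mod_cast k2
  have e3 : p.2 < p₀.2 + 1 := by exact_mod_cast k3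
  have e4 : p₀.2 < p.2 + 1 := by exact_mod_cast k4
  exact Prod.ext (by omega) (by omega)

/-- The closed square is contained in the closure of the open square (for positive mesh they are
equal). [folklore] -/
theorem gridSquare_subset_closure_gridOpenSquare (hδ : 0 < δ) (p : ℤ × ℤ) :
    gridSquare δ p ⊆ closure (gridOpenSquare δ p) := by
  have h1 : ((p.1 : ℤ) : ℝ) * δ < (p.1 + 1) * δ := by nlinarith
  have h2 : ((p.2 : ℤ) : ℝ) * δ < (p.2 + 1) * δ := by nlinarith
  rw [gridOpenSquare, closure_reProdIm, closure_Ioo h1.ne, closure_Ioo h2.ne]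
  rfl

/-- Two points of the same closed grid square are at distance at most `2δ`. [folklore] -/
theorem dist_le_of_mem_gridSquare {p : ℤ × ℤ} {z w : ℂ} (hz : z ∈ gridSquare δ p)
    (hw : w ∈ gridSquare δ p) : dist z w ≤ 2 * δ := by
  obtain ⟨⟨h1, h2⟩, ⟨h3, h4⟩⟩ := hz
  obtain ⟨⟨h5, h6⟩, ⟨h7, h8⟩⟩ := hw
  rw [dist_eq_norm]
  refine (norm_le_abs_re_add_abs_im _).trans ?_
  rw [sub_re, sub_im]
  have hre : |z.re - w.re| ≤ δ := abs_sub_le_iff.2 ⟨by linarith, by linarith⟩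
  have him : |z.im - w.im| ≤ δ := abs_sub_le_iff.2 ⟨by linarith, by linarith⟩
  linarith

/-- The horizontal edge `q` is the bottom edge of the square `q`. [folklore] -/
theorem gridHEdge_subset_gridSquare (hδ : 0 ≤ δ) (q : ℤ × ℤ) :
    gridHEdge δ q ⊆ gridSquare δ q := by
  rintro z ⟨hre, him⟩
  refine ⟨hre, ?_⟩
  rw [mem_preimage, mem_singleton_iff] at him
  refine ⟨him.ge, ?_⟩
  rw [him]
  nlinarith

/-- The horizontal edge `q` is the top edge of the square `(q.1, q.2 - 1)`. [folklore] -/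
theorem gridHEdge_subset_gridSquare_down (hδ : 0 ≤ δ) (q : ℤ × ℤ) :
    gridHEdge δ q ⊆ gridSquare δ (q.1, q.2 - 1) := by
  rintro z ⟨hre, him⟩
  refine ⟨hre, ?_⟩
  rw [mem_preimage, mem_singleton_iff] at him
  refine ⟨?_, ?_⟩
  · rw [him]; push_cast; nlinarith
  · rw [him]; push_cast; nlinarith

/-- The vertical edge `q` is the left edge of the square `q`. [folklore] -/
theorem gridVEdge_subset_gridSquare (hδ : 0 ≤ δ) (q : ℤ × ℤ) :
    gridVEdge δ q ⊆ gridSquare δ q := by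
  rintro z ⟨hre, him⟩
  refine ⟨?_, him⟩
  rw [mem_preimage, mem_singleton_iff] at hre
  refine ⟨hre.ge, ?_⟩
  rw [hre]
  nlinarith

/-- The vertical edge `q` is the right edge of the square `(q.1 - 1, q.2)`. [folklore] -/
theorem gridVEdge_subset_gridSquare_left (hδ : 0 ≤ δ) (q : ℤ × ℤ) :
    gridVEdge δ q ⊆ gridSquare δ (q.1 - 1, q.2) := by
  rintro z ⟨hre, him⟩
  refine ⟨?_, him⟩
  rw [mem_preimage, mem_singleton_iff] at hre
  refine ⟨?_, ?_⟩
  · rw [hre]; push_cast; nlinarith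
  · rw [hre]; push_cast; nlinarith

/-- The open square misses every horizontal grid edge. [folklore] -/
theorem disjoint_gridOpenSquare_gridHEdge (hδ : 0 < δ) (p q : ℤ × ℤ) :
    Disjoint (gridOpenSquare δ p) (gridHEdge δ q) := by
  rw [Set.disjoint_left]
  rintro z ⟨-, ⟨h3, h4⟩⟩ ⟨-, him⟩
  rw [mem_preimage, mem_singleton_iff] at him
  rw [him] at h3 h4
  have k1 : ((p.2 : ℤ) : ℝ) < q.2 := lt_of_mul_lt_mul_right h3 hδ.le
  have k2 : ((q.2 : ℤ) : ℝ) < p.2 + 1 := lt_of_mul_lt_mul_right h4 hδ.le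
  have e1 : p.2 < q.2 := by exact_mod_cast k1
  have e2 : q.2 < p.2 + 1 := by exact_mod_cast k2
  omega

/-- The open square misses every vertical grid edge. [folklore] -/
theorem disjoint_gridOpenSquare_gridVEdge (hδ : 0 < δ) (p q : ℤ × ℤ) :
    Disjoint (gridOpenSquare δ p) (gridVEdge δ q) := by
  rw [Set.disjoint_left]
  rintro z ⟨⟨h1, h2⟩, -⟩ ⟨hre, -⟩
  rw [mem_preimage, mem_singleton_iff] at hre
  rw [hre] at h1 h2
  have k1 : ((p.1 : ℤ) : ℝ) < q.1 := lt_of_mul_lt_mul_right h1 hδ.le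
  have k2 : ((q.1 : ℤ) : ℝ) < p.1 + 1 := lt_of_mul_lt_mul_right h2 hδ.le
  have e1 : p.1 < q.1 := by exact_mod_cast k1
  have e2 : q.1 < p.1 + 1 := by exact_mod_cast k2
  omega

end Geometry

/-! ### Cauchy's theorem and formula for one grid square -/

/-- Cauchy–Goursat for a grid square: if `g` is holomorphic on the closed square then its
boundary integral vanishes (Mathlib's `Complex.integral_boundary_rect_eq_zero_of_differentiableOn`
in grid coordinates). [folklore] -/
theorem gridBoundaryIntegral_eq_zero (hδ : 0 < δ) {p : ℤ × ℤ} {g : ℂ → ℂ}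
    (hg : DifferentiableOn ℂ g (gridSquare δ p)) : gridBoundaryIntegral δ p g = 0 := by
  have h1 : ((p.1 : ℤ) : ℝ) * δ ≤ (p.1 + 1) * δ := by nlinarith
  have h2 : ((p.2 : ℤ) : ℝ) * δ ≤ (p.2 + 1) * δ := by nlinarith
  have := Complex.integral_boundary_rect_eq_zero_of_differentiableOn g
    ((p.1 : ℝ) * δ + ((p.2 : ℝ) * δ) * I) ((p.1 + 1 : ℝ) * δ + ((p.2 + 1 : ℝ) * δ) * I)
    (by simpa [uIcc_of_le h1, uIcc_of_le h2, gridSquare] using hg)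
  simp only [add_re, ofReal_re, mul_re, I_re, mul_zero, ofReal_im, I_im, mul_one,
    add_zero, add_im, mul_im, zero_add, smul_eq_mul] at this
  simpa [gridBoundaryIntegral, gridHIntegral, gridVIntegral] using this

/-- Cauchy's integral formula for a grid square: for `f` holomorphic on the closed square and `z`
in the open square, `∮_{∂Q} f(w)/(w - z) dw = 2πi f(z)`
(`Literature.Analysis.Complex.integral_boundary_rect_div_sub_eq` in grid coordinates). [folklore] -/
theorem gridBoundaryIntegral_div_sub_eq {p : ℤ × ℤ} {f : ℂ → ℂ} {z : ℂ}
    (hf : DifferentiableOn ℂ f (gridSquare δ p)) (hz : z ∈ gridOpenSquare δ p) :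
    gridBoundaryIntegral δ p (fun w ↦ f w / (w - z)) = 2 * Real.pi * I * f z := by
  obtain ⟨⟨h1, h2⟩, ⟨h3, h4⟩⟩ := hz
  have := Literature.Analysis.Complex.integral_boundary_rect_div_sub_eq z h1 h2 h3 h4 hf
  simpa [gridBoundaryIntegral, gridHIntegral, gridVIntegral] using this

/-! ### Continuity of Cauchy-type integrals in the parameter -/

/-- **Continuity of a Cauchy-type integral off the path.** For `γ, φ` continuous on `[a, b]`,
the function `z ↦ ∫_a^b φ(x) / (γ(x) - z) dx` is continuous on the complement of `γ([a, b])`.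
[folklore] -/
theorem continuousOn_integral_div_sub {γ φ : ℝ → ℂ} {a b : ℝ} (hab : a ≤ b)
    (hγ : ContinuousOn γ (Icc a b)) (hφ : ContinuousOn φ (Icc a b)) :
    ContinuousOn (fun z : ℂ ↦ ∫ x in a..b, φ x / (γ x - z)) (γ '' Icc a b)ᶜ := by
  -- clamp the parametrisations to `[a, b]`
  set γ' : ℝ → ℂ := IccExtend hab (fun x ↦ γ x) with hγ'
  set φ' : ℝ → ℂ := IccExtend hab (fun x ↦ φ x) with hφ'
  have hγ'c : Continuous γ' := (continuous_IccExtend_iff).2 hγ.restrict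
  have hφ'c : Continuous φ' := (continuous_IccExtend_iff).2 hφ.restrict
  have hγ'eq : EqOn γ' γ (Icc a b) := fun x hx ↦ IccExtend_of_mem hab _ hx
  have hφ'eq : EqOn φ' φ (Icc a b) := fun x hx ↦ IccExtend_of_mem hab _ hx
  have hγ'mem : ∀ x, γ' x ∈ γ '' Icc a b := fun x ↦
    ⟨projIcc a b hab x, (projIcc a b hab x).2, rfl⟩
  have heq : ∀ z, ∫ x in a..b, φ x / (γ x - z) = ∫ x in a..b, φ' x / (γ' x - z) := by
    intro z
    refine intervalIntegral.integral_congr fun x hx ↦ ?_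
    rw [uIcc_of_le hab] at hx
    simp only [hγ'eq hx, hφ'eq hx]
  simp_rw [heq]
  rw [continuousOn_iff_continuous_restrict]
  have hF : Continuous (Function.uncurry fun (z : ↥(γ '' Icc a b)ᶜ) (x : ℝ) ↦ φ' x / (γ' x - z)) := by
    refine (hφ'c.comp continuous_snd).div ((hγ'c.comp continuous_snd).sub
      (continuous_subtype_val.comp continuous_fst)) fun q ↦ ?_
    exact sub_ne_zero.2 fun h ↦ q.1.2 (h ▸ hγ'mem q.2)
  exact intervalIntegral.continuous_parametric_intervalIntegral_of_continuous' hF a b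


/-! ### Cauchy's formula over a grid cycle -/

/-- **Cauchy's integral formula over a grid cycle** (Conway VIII.1.1). Let `K` be a compact
subset of the open set `Ω ⊆ ℂ`. There are a mesh `δ > 0` and finitely many horizontal and
vertical grid segments (those grid edges `q ∈ T` with nonzero coefficient `gridHCoeff S q`,
resp. `gridVCoeff S q`, of the grid cycle `∑_{p ∈ S} ∂Q_p` of the squares `S` meeting `K`), all
contained in `Ω \ K`, such that for **every** `f` holomorphic on `Ω` and every `z ∈ K`,
`f(z) = (2πi)⁻¹ ∑_edges coeff · ∫_edge f(w)/(w - z) dw` (vertical edges carry the factor `i` of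
`dz = i dy`). Conway, *Functions of One Complex Variable I* (1978), Ch. VIII Prop. 1.1. [cite: Conway1978, Ch. VIII Prop. 1.1] -/
theorem exists_grid_cauchy_formula {Ω K : Set ℂ} (hΩ : IsOpen Ω) (hK : IsCompact K)
    (hKΩ : K ⊆ Ω) :
    ∃ (δ : ℝ) (S T : Finset (ℤ × ℤ)), 0 < δ ∧
      (∀ q ∈ T, gridHCoeff S q ≠ 0 → gridHEdge δ q ⊆ Ω \ K) ∧
      (∀ q ∈ T, gridVCoeff S q ≠ 0 → gridVEdge δ q ⊆ Ω \ K) ∧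
      ∀ f : ℂ → ℂ, DifferentiableOn ℂ f Ω → ∀ z ∈ K,
        ∑ q ∈ T, (gridHCoeff S q : ℂ) * gridHIntegral δ q (fun w ↦ f w / (w - z)) +
          I * ∑ q ∈ T, (gridVCoeff S q : ℂ) * gridVIntegral δ q (fun w ↦ f w / (w - z)) =
        2 * Real.pi * I * f z := by
  classical
  -- the mesh
  obtain ⟨ε, hε, hεΩ⟩ := hK.exists_cthickening_subset_open hΩ hKΩ
  set δ : ℝ := ε / 3 with hδ_def
  have hδ : 0 < δ := by positivity
  have hδε : 2 * δ ≤ ε := by rw [hδ_def]; linarith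
  -- squares meeting `K` lie in `Ω`
  have hsqΩ : ∀ p, (gridSquare δ p ∩ K).Nonempty → gridSquare δ p ⊆ Ω := by
    rintro p ⟨z, hzp, hzK⟩ w hw
    exact hεΩ (mem_cthickening_of_dist_le w z ε K hzK ((dist_le_of_mem_gridSquare hw hzp).trans hδε))
  -- the finite set of squares meeting `K`
  obtain ⟨R, hR⟩ := hK.isBounded.exists_norm_le
  set N : ℤ := ⌈R / δ⌉ + 1 with hN
  set S : Finset (ℤ × ℤ) :=
    (Finset.Icc (-N) N ×ˢ Finset.Icc (-N) N).filter (fun p ↦ (gridSquare δ p ∩ K).Nonempty)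
    with hS_def
  have hS : ∀ p, (gridSquare δ p ∩ K).Nonempty → p ∈ S := by
    rintro p ⟨z, ⟨⟨h1, h2⟩, ⟨h3, h4⟩⟩, hzK⟩
    have hz := hR z hzK
    have hre := (abs_le.1 ((abs_re_le_norm z).trans hz))
    have him := (abs_le.1 ((abs_im_le_norm z).trans hz))
    have hceil : R / δ ≤ ⌈R / δ⌉ := Int.le_ceil _
    have k1 : (p.1 : ℝ) ≤ R / δ := by rw [le_div_iff₀ hδ]; linarith
    have k2 : -(R / δ) ≤ p.1 + 1 := by rw [neg_le, le_div_iff₀ hδ]; linarith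
    have k3 : (p.2 : ℝ) ≤ R / δ := by rw [le_div_iff₀ hδ]; linarith
    have k4 : -(R / δ) ≤ p.2 + 1 := by rw [neg_le, le_div_iff₀ hδ]; linarith
    have e1 : p.1 ≤ ⌈R / δ⌉ := by exact_mod_cast k1.trans hceil
    have e2 : -⌈R / δ⌉ ≤ p.1 + 1 := by exact_mod_cast (neg_le_neg hceil).trans k2
    have e3 : p.2 ≤ ⌈R / δ⌉ := by exact_mod_cast k3.trans hceil
    have e4 : -⌈R / δ⌉ ≤ p.2 + 1 := by exact_mod_cast (neg_le_neg hceil).trans k4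
    refine Finset.mem_filter.2 ⟨Finset.mem_product.2 ⟨Finset.mem_Icc.2 ⟨?_, ?_⟩,
      Finset.mem_Icc.2 ⟨?_, ?_⟩⟩, ⟨z, ⟨⟨h1, h2⟩, ⟨h3, h4⟩⟩, hzK⟩⟩ <;> omega
  have hS' : ∀ p ∈ S, gridSquare δ p ⊆ Ω := fun p hp ↦ hsqΩ p (Finset.mem_filter.1 hp).2
  set T : Finset (ℤ × ℤ) := S ∪ (S.image (fun p ↦ (p.1, p.2 + 1)) ∪ S.image (fun p ↦ (p.1 + 1, p.2)))
    with hT_def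
  have hST : S ⊆ T := Finset.subset_union_left
  have hup : S.image (fun p ↦ (p.1, p.2 + 1)) ⊆ T :=
    Finset.subset_union_left.trans Finset.subset_union_right
  have hright : S.image (fun p ↦ (p.1 + 1, p.2)) ⊆ T :=
    Finset.subset_union_right.trans Finset.subset_union_right
  -- the surviving edges lie in `Ω \ K`
  have hHedge : ∀ q, gridHCoeff S q ≠ 0 → gridHEdge δ q ⊆ Ω \ K := by
    intro q hq
    have hq' : q ∈ S ∨ (q.1, q.2 - 1) ∈ S := by
      by_contra h
      simp [gridHCoeff, not_or.1 h] at hq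
    refine subset_sdiff.2 ⟨?_, ?_⟩
    · rcases hq' with h | h
      · exact (gridHEdge_subset_gridSquare hδ.le q).trans (hS' _ h)
      · exact (gridHEdge_subset_gridSquare_down hδ.le q).trans (hS' _ h)
    · rw [Set.disjoint_left]
      intro z hz hzK
      have h1 : q ∈ S := hS q ⟨z, gridHEdge_subset_gridSquare hδ.le q hz, hzK⟩
      have h2 : (q.1, q.2 - 1) ∈ S := hS _ ⟨z, gridHEdge_subset_gridSquare_down hδ.le q hz, hzK⟩
      simp [gridHCoeff, h1, h2] at hq
  have hVedge : ∀ q, gridVCoeff S q ≠ 0 → gridVEdge δ q ⊆ Ω \ K := by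
    intro q hq
    have hq' : (q.1 - 1, q.2) ∈ S ∨ q ∈ S := by
      by_contra h
      simp [gridVCoeff, not_or.1 h] at hq
    refine subset_sdiff.2 ⟨?_, ?_⟩
    · rcases hq' with h | h
      · exact (gridVEdge_subset_gridSquare_left hδ.le q).trans (hS' _ h)
      · exact (gridVEdge_subset_gridSquare hδ.le q).trans (hS' _ h)
    · rw [Set.disjoint_left]
      intro z hz hzK
      have h1 : q ∈ S := hS q ⟨z, gridVEdge_subset_gridSquare hδ.le q hz, hzK⟩
      have h2 : (q.1 - 1, q.2) ∈ S := hS _ ⟨z, gridVEdge_subset_gridSquare_left hδ.le q hz, hzK⟩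
      simp [gridVCoeff, h1, h2] at hq
  refine ⟨δ, S, T, hδ, fun q _ hq ↦ hHedge q hq, fun q _ hq ↦ hVedge q hq, ?_⟩
  -- the formula
  intro f hf z hzK
  set p₀ : ℤ × ℤ := (⌊z.re / δ⌋, ⌊z.im / δ⌋) with hp₀
  have hzp₀ : z ∈ gridSquare δ p₀ := mem_gridSquare_floor hδ z
  have hp₀S : p₀ ∈ S := hS p₀ ⟨z, hzp₀, hzK⟩
  set Φ : ℂ → ℂ := fun w ↦
    ∑ q ∈ T, (gridHCoeff S q : ℂ) * gridHIntegral δ q (fun x ↦ f x / (x - w)) +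
      I * ∑ q ∈ T, (gridVCoeff S q : ℂ) * gridVIntegral δ q (fun x ↦ f x / (x - w)) with hΦ
  -- (A) the formula on the open square of `p₀`
  have hA : EqOn Φ (fun w ↦ 2 * Real.pi * I * f w) (gridOpenSquare δ p₀) := by
    intro w hw
    have hsum := sum_gridBoundaryIntegral_eq (δ := δ) hST hup hright (fun x ↦ f x / (x - w))
    simp only [hΦ]
    rw [← hsum, Finset.sum_eq_single_of_mem p₀ hp₀S]
    · exact gridBoundaryIntegral_div_sub_eq (hf.mono (hS' p₀ hp₀S)) hw
    · intro p hp hne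
      refine gridBoundaryIntegral_eq_zero hδ ((hf.mono (hS' p hp)).div ?_ ?_)
      · exact differentiableOn_id.sub_const w
      · intro x hx
        exact sub_ne_zero.2 fun h ↦ hne (eq_of_mem_gridOpenSquare_of_mem_gridSquare hδ hw (h ▸ hx))
  -- (B) continuity of `Φ` off the surviving edges
  set B : Set ℂ := (⋃ q ∈ T.filter (fun q ↦ gridHCoeff S q ≠ 0), gridHEdge δ q) ∪
    ⋃ q ∈ T.filter (fun q ↦ gridVCoeff S q ≠ 0), gridVEdge δ q with hB
  have hfc : ContinuousOn f Ω := hf.continuousOn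
  have hB : ContinuousOn Φ Bᶜ := by
    simp only [hΦ]
    refine (continuousOn_finsetSum T fun q hq ↦ ?_).add
      (continuousOn_const.mul (continuousOn_finsetSum T fun q hq ↦ ?_))
    · by_cases hc : gridHCoeff S q = 0
      · simp only [hc, Int.cast_zero, zero_mul]
        exact continuousOn_const
      · have hab : (q.1 : ℝ) * δ ≤ (q.1 + 1) * δ := by nlinarith
        have hedge := hHedge q hc
        have hmem : ∀ x ∈ Icc ((q.1 : ℝ) * δ) ((q.1 + 1) * δ),
            (x : ℂ) + (((q.2 : ℝ) * δ : ℝ) : ℂ) * I ∈ gridHEdge δ q := fun x hx ↦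
          ⟨by simpa using hx, by simp⟩
        have hγ : ContinuousOn (fun x : ℝ ↦ (x : ℂ) + (((q.2 : ℝ) * δ : ℝ) : ℂ) * I)
            (Icc ((q.1 : ℝ) * δ) ((q.1 + 1) * δ)) := by fun_prop
        have hφ : ContinuousOn (fun x : ℝ ↦ f ((x : ℂ) + (((q.2 : ℝ) * δ : ℝ) : ℂ) * I))
            (Icc ((q.1 : ℝ) * δ) ((q.1 + 1) * δ)) :=
          hfc.comp hγ fun x hx ↦ (hedge (hmem x hx)).1
        refine continuousOn_const.mul ((continuousOn_integral_div_sub hab hγ hφ).mono ?_)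
        refine compl_subset_compl.2 ?_
        rintro _ ⟨x, hx, rfl⟩
        exact Or.inl (subset_biUnion_of_mem (u := fun q ↦ gridHEdge δ q)
          (Finset.mem_filter.2 ⟨hq, hc⟩) (hmem x hx))
    · by_cases hc : gridVCoeff S q = 0
      · simp only [hc, Int.cast_zero, zero_mul]
        exact continuousOn_const
      · have hab : (q.2 : ℝ) * δ ≤ (q.2 + 1) * δ := by nlinarith
        have hedge := hVedge q hc
        have hmem : ∀ y ∈ Icc ((q.2 : ℝ) * δ) ((q.2 + 1) * δ),
            ((((q.1 : ℝ) * δ : ℝ) : ℂ) + (y : ℂ) * I) ∈ gridVEdge δ q := fun y hy ↦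
          ⟨by simp, by simpa using hy⟩
        have hγ : ContinuousOn (fun y : ℝ ↦ (((q.1 : ℝ) * δ : ℝ) : ℂ) + (y : ℂ) * I)
            (Icc ((q.2 : ℝ) * δ) ((q.2 + 1) * δ)) := by fun_prop
        have hφ : ContinuousOn (fun y : ℝ ↦ f ((((q.1 : ℝ) * δ : ℝ) : ℂ) + (y : ℂ) * I))
            (Icc ((q.2 : ℝ) * δ) ((q.2 + 1) * δ)) :=
          hfc.comp hγ fun y hy ↦ (hedge (hmem y hy)).1
        refine continuousOn_const.mul ((continuousOn_integral_div_sub hab hγ hφ).mono ?_)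
        refine compl_subset_compl.2 ?_
        rintro _ ⟨y, hy, rfl⟩
        exact Or.inr (subset_biUnion_of_mem (u := fun q ↦ gridVEdge δ q)
          (Finset.mem_filter.2 ⟨hq, hc⟩) (hmem y hy))
  -- (C) extend the formula to `z` by continuity
  have hzB : z ∉ B := by
    rintro (h | h) <;> simp only [mem_iUnion, Finset.mem_filter, exists_prop] at h
    · obtain ⟨q, ⟨-, hc⟩, hzq⟩ := h
      exact (hHedge q hc hzq).2 hzK
    · obtain ⟨q, ⟨-, hc⟩, hzq⟩ := h
      exact (hVedge q hc hzq).2 hzK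
  have hsqB : Disjoint (gridOpenSquare δ p₀) B := by
    refine Disjoint.union_right ?_ ?_ <;> refine disjoint_iUnion₂_right.2 fun q _ ↦ ?_
    · exact disjoint_gridOpenSquare_gridHEdge hδ p₀ q
    · exact disjoint_gridOpenSquare_gridVEdge hδ p₀ q
  have ht : insert z (gridOpenSquare δ p₀) ⊆ Bᶜ := by
    rintro w (rfl | hw)
    · exact hzB
    · exact hsqB.notMem_of_mem_left hw
  have hopen_sub : gridOpenSquare δ p₀ ⊆ gridSquare δ p₀ := fun w hw ↦
    ⟨Ioo_subset_Icc_self hw.1, Ioo_subset_Icc_self hw.2⟩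
  have htΩ : insert z (gridOpenSquare δ p₀) ⊆ Ω := by
    rintro w (rfl | hw)
    · exact hKΩ hzK
    · exact hS' p₀ hp₀S (hopen_sub hw)
  have key := hA.of_subset_closure (hB.mono ht) ((continuousOn_const.mul hfc).mono htΩ)
    (subset_insert _ _) (insert_subset (gridSquare_subset_closure_gridOpenSquare hδ p₀ hzp₀)
      subset_closure)
  exact key (mem_insert _ _)

end Complex

end
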